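import Summits.QuantumFields.BalabanUV.Beta.D1BFx.RWeightedLegPack
import Summits.QuantumFields.BalabanUV.Beta.D1BFx.SortedRelInv

/-!
# `BalabanUV.Beta.D1BFx.RWeightedLegPackSymm` — road «BF-x», binder row D1, slot (K), debt X₃(ii) ROUTE T, `K-ASSEMBLY-SPEC-v2.md` §1 brick
# **3b-P «THE PACKED N-LEG»**, PART 2 (of 3): BLOCK COVARIANCE under `n•ℤ⁴` and SYMMETRY `trK NlegK = NlegK` of the packed N-leg
# `NlegK = pack(½Γ_R, ℋ_R, ℋ♭_R, 2(a′δ − Cun′))` of PART 1 (`RWeightedLegPack`), generic and at the road's legs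

WHY (`HOME/b2b-balaban-beta-d1-p2/K-ASSEMBLY-SPEC-v2.md` §1 rows 3b-P ∕ 3c).  Block covariance is the `hKc` hypothesis of leaf-03's product rule
`SortedRelInv.periodise_sortK_comp` and of TA1's `isPeriodic₂_sortK` (joint periodicity of the sorted fibres on every coarse torus); symmetry is what
makes `N_T⁻¹ = blocksHat p (sortK n NlegK)` a symmetric matrix and `ℋ♭_R = (ℋ_R)ᵀ` (one read-out instead of two in PART 3).
CONTENT (d = 3; block side `n ≥ 1`; generic fine leg `Ga`, coarse kernel `Cm`, mass `a′`; all [folklore]):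
* §1 block covariance: `shiftK_embC` (translation-invariant `Cm`), `shiftK_packK`, `shiftK_Gp`, `shiftK_Qp` (`SortedRelInv.shiftK_bhK`), `shiftK_Cp`,
  **`shiftK_NlegK`** (`comp_shiftK`), **`shiftK_NlegRoad`** (`GluonLeg.shiftK_Ga`, `CoarseGramInverse.multM_translate`).
* §2 symmetry: `trK_Gp`, `trK_Cp`, **`trK_HRp : (ℋ_R)ᵀ = ℋ♭_R`**, `trK_HRbp`, `trK_sandP`, **`trK_NlegK`** (symmetric spread `Ga`, `Cm`; `trK_comp`,
  `comp_assoc_tame`, `PackedParity.trK_packK`), **`multM_symm`** (`TransverseDictionary.wΦ_reciprocity`), **`trK_NlegRoad`** (`GluonLeg.Ga_symm`; modulo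
  `Spr (Ga (m+1) a)`).
NOT HERE: PART 3 (read-out of the fm∕mf blocks as `LandauDictionaryH.HRcol` ∕ `wH`), 3c's torus identities.

HONEST FRAMING (cell contract, verbatim): «discharging `BetaPertH` makes Bałaban's UV stability UNCONDITIONAL — a real constructive-QFT
result; it is NOT the continuum limit and NOT the Clay problem.»  HONEST DEPENDENCY (verbatim): «continuum YM on T⁴ ⇐ BetaPertH ∧ nine
spine estimates (0/9 proved); BetaPertH ⇐ (D1) ∧ (D4) ∧ CAP+tail; G-an2-4 gates asym, D1 and NE2/3/4.»  [folklore] kernel bookkeeping over PART 1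
and the modules it names, BY NAME; no `Prop` is minted, nothing is cited, no wall binder is instantiated; 0 sorry.  0∕4 binders; (K) NOT closed;
NOT D1, NOT BetaPertH, NOT summit progress.  ABSOLUTE RULE (cell, verbatim): «No internally-minted statement may enter as a cited fact. Every
hypothesis is either kernel-proved in this package or a verbatim quotation of a PUBLISHED theorem with page reference. The manuscript(s) under
audit are NOT citable for their own disputed steps — they are the thing under adjudication; programme-internal (2001/route/tribunal) claims are
never citable.»
Provenance: NE9 formalisation swarm leaf prover `b2b-balaban-t4-ne9-formalise-leaf-06` (gen 29), cross-row brick «K-3b-P», 2026-08-20.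
-/

noncomputable section

namespace Summit.QuantumFields.BalabanUV.Beta.D1BFx.RWeightedLegPack

open Literature.Probability.LatticeModels (TorusSite Torus.proj)
open Literature.MathematicalPhysics.QuantumFieldTheory.LatticeForm (quo proj_add_zsmul)
open Literature.MathematicalPhysics.QuantumFieldTheory.Balaban1983to89
open Literature.MathematicalPhysics.QuantumFieldTheory.Balaban1983to89.Beta
open BlochFibreUniqueness (quo_add_zsmul)
open ExpKernelCalculus (MKer Decays comp shiftK comp_shiftK)
open OneStepResolventKernel (Fib)
open Summit.QuantumFields.BalabanUV.Beta.TameKernelCalculus (Tame Spr Spr.tame spr_idK trK trK_apply trK_comp comp_assoc_tame)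
open Summit.QuantumFields.BalabanUV.Beta.ChartConjugationRelative (spr_comp)
open Summit.QuantumFields.BalabanUV.Beta.BorderedHessian (bhK)
open Summit.QuantumFields.BalabanUV.Beta.D1BFx.PackedKernelSplit (blk packK)
open Summit.QuantumFields.BalabanUV.Beta.D1BFx.PackedParity (trK_packK)
open Summit.QuantumFields.BalabanUV.Beta.D1BFx.SortedRelInv (shiftK_bhK)
open Summit.QuantumFields.BalabanUV.Beta.D1BFx.CoarseGramInverse (multM multM_apply multM_translate spr_multM)
open Summit.QuantumFields.BalabanUV.Beta.D1BFx.GluonLeg (Ga_symm shiftK_Ga)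
open Summit.QuantumFields.BalabanUV.Beta.GAN24.TransverseDictionary (wΦ_reciprocity)
open scoped BigOperators

variable (n : ℕ)

/-! ## §1 Block covariance under the translations of `n•ℤ⁴` -/

section Covariance
variable [NeZero n] {Ga Cm : MKer 4 (Fin 4)}

/-- [folklore] A placed TRANSLATION-INVARIANT coarse kernel is block covariant. -/
theorem shiftK_embC (hCm : ∀ (y y' v : Fin 4 → ℤ) (m l : Fin 4), Cm (y + v) (y' + v) m l = Cm y y' m l) (t : Fin 4 → ℤ) :
    shiftK ((n : ℤ) • t) (embC n Cm) = embC n Cm := by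
  funext x y m l
  simp only [shiftK, embC_apply, proj_add_zsmul, quo_add_zsmul, hCm]

omit [NeZero n] in
/-- [folklore] Shifting a packed kernel shifts its blocks. -/
theorem shiftK_packK (v : Fin 4 → ℤ) (A B C E : MKer 4 (Fin 4)) :
    shiftK v (packK A B C E : MKer 4 (Fib 3)) = packK (shiftK v A) (shiftK v B) (shiftK v C) (shiftK v E) := by
  funext x y a b
  cases a <;> cases b <;> rfl

omit [NeZero n] in
/-- [folklore] The fine-leg pack of a block-covariant leg is block covariant. -/
theorem shiftK_Gp (hGa : ∀ t : Fin 4 → ℤ, shiftK ((n : ℤ) • t) Ga = Ga) (t : Fin 4 → ℤ) : shiftK ((n : ℤ) • t) (Gp Ga) = Gp Ga := by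
  rw [Gp, shiftK_packK, hGa]; rfl

/-- [folklore] The 𝒬-pack is block covariant (`SortedRelInv.shiftK_bhK`). -/
theorem shiftK_Qp (t : Fin 4 → ℤ) : shiftK ((n : ℤ) • t) (Qp n) = Qp n := by
  have h := shiftK_bhK (d := 3) (N := n) t
  have hb : shiftK ((n : ℤ) • t) (blk (bhK (d := 3) n) false true) = blk (bhK (d := 3) n) false true := by
    funext x y a b
    exact congrFun (congrFun (congrFun (congrFun h x) y) (Sum.inr a)) (Sum.inl b)
  rw [Qp, shiftK_packK, hb]; rfl

/-- [folklore] Its transpose too. -/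
theorem shiftK_trK_Qp (t : Fin 4 → ℤ) : shiftK ((n : ℤ) • t) (trK (Qp n)) = trK (Qp n) := by
  funext x y a b
  have h := congrFun (congrFun (congrFun (congrFun (shiftK_Qp n t) y) x) b) a
  simpa only [shiftK, trK_apply] using h

/-- [folklore] The coarse-multiplier pack of a translation-invariant coarse kernel is block covariant. -/
theorem shiftK_Cp (hCm : ∀ (y y' v : Fin 4 → ℤ) (m l : Fin 4), Cm (y + v) (y' + v) m l = Cm y y' m l) (t : Fin 4 → ℤ) :
    shiftK ((n : ℤ) • t) (Cp n Cm) = Cp n Cm := by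
  rw [Cp, shiftK_packK, shiftK_embC n hCm]; rfl

/-- [folklore] **THE PACKED N-LEG IS BLOCK COVARIANT** (⟸ block covariance of `Ga`, translation invariance of `Cm`; `comp_shiftK`). -/
theorem shiftK_NlegK (hGa : ∀ t : Fin 4 → ℤ, shiftK ((n : ℤ) • t) Ga = Ga)
    (hCm : ∀ (y y' v : Fin 4 → ℤ) (m l : Fin 4), Cm (y + v) (y' + v) m l = Cm y y' m l) (a' : ℝ) (t : Fin 4 → ℤ) :
    shiftK ((n : ℤ) • t) (NlegK n Ga Cm a') = NlegK n Ga Cm a' := by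
  have hG := shiftK_Gp n hGa t
  have hQ := shiftK_Qp n t
  have hQt := shiftK_trK_Qp n t
  have hC := shiftK_Cp n hCm t
  have hC' : shiftK ((n : ℤ) • t) (Cp n (a' • HessKerSchurResolvent.idK - Cm)) = Cp n (a' • HessKerSchurResolvent.idK - Cm) := by
    refine shiftK_Cp n (fun y y' v m l => ?_) t
    simp only [Pi.sub_apply, Pi.smul_apply, smul_eq_mul, HessKerSchurResolvent.idK_apply, add_left_inj, hCm]
  have hHR : shiftK ((n : ℤ) • t) (HRp n Ga Cm) = HRp n Ga Cm := by
    rw [HRp, ← comp_shiftK, ← comp_shiftK, hG, hQt, hC]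
  have hHRb : shiftK ((n : ℤ) • t) (HRbp n Ga Cm) = HRbp n Ga Cm := by
    rw [HRbp, ← comp_shiftK, ← comp_shiftK, hG, hQ, hC]
  have hS : shiftK ((n : ℤ) • t) (sandP n Ga Cm) = sandP n Ga Cm := by
    rw [sandP, ← comp_shiftK, ← comp_shiftK, hHR, hQ, hG]
  funext x y a b
  simp only [NlegK, shiftK, Pi.add_apply, Pi.sub_apply, Pi.smul_apply, smul_eq_mul]
  have e1 := congrFun (congrFun (congrFun (congrFun hG x) y) a) b
  have e2 := congrFun (congrFun (congrFun (congrFun hHR x) y) a) b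
  have e3 := congrFun (congrFun (congrFun (congrFun hHRb x) y) a) b
  have e4 := congrFun (congrFun (congrFun (congrFun hS x) y) a) b
  have e5 := congrFun (congrFun (congrFun (congrFun hC' x) y) a) b
  simp only [shiftK] at e1 e2 e3 e4 e5
  rw [e1, e2, e3, e4, e5]

omit [NeZero n] in
/-- [folklore] **THE ROAD'S N-LEG IS BLOCK COVARIANT** under `(m+1)•ℤ⁴` (`GluonLeg.shiftK_Ga`, `CoarseGramInverse.multM_translate`). -/
theorem shiftK_NlegRoad (m : ℕ) (a : ℝ) (t : Fin 4 → ℤ) : shiftK (((m + 1 : ℕ) : ℤ) • t) (NlegRoad m a) = NlegRoad m a :=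
  shiftK_NlegK (m + 1) (fun t => shiftK_Ga (m + 1) a (Nat.le_add_left 1 m) t)
    (fun y y' v m' l => multM_translate (m + 1) _ _ y y' v m' l) _ t

end Covariance

/-! ## §2 Symmetry -/

section Symmetry
variable [NeZero n] {Ga Cm : MKer 4 (Fin 4)}

omit [NeZero n] in
/-- [folklore] The transpose of the zero kernel. -/
theorem trK_zero' {D : ℕ} {F : Type*} : trK (0 : MKer D F) = 0 := rfl

omit [NeZero n] in
/-- [folklore] The fine-leg pack of a symmetric leg is symmetric. -/
theorem trK_Gp (hGaSymm : ∀ x z κ m, Ga x z κ m = Ga z x m κ) : trK (Gp Ga) = Gp Ga := by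
  have h : trK Ga = Ga := by funext x y κ l; exact (hGaSymm y x l κ)
  rw [Gp, trK_packK, h, trK_zero']

omit [NeZero n] in
/-- [folklore] The coarse-multiplier pack of a symmetric coarse kernel is symmetric. -/
theorem trK_Cp (hCmSymm : ∀ y y' m l, Cm y y' m l = Cm y' y l m) : trK (Cp n Cm) = Cp n Cm := by
  have h : trK (embC n Cm) = embC n Cm := by
    funext x y m l
    simp only [trK_apply, embC_apply, hCmSymm (quo n y) (quo n x) l m]
    split_ifs with h1 h2 h2
    · rfl
    · exact absurd h1.symm h2
    · exact absurd h2.symm h1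
    · rfl
  rw [Cp, trK_packK, h, trK_zero']

/-- [folklore] **`(ℋ_R)ᵀ = ℋ♭_R`** for symmetric spread `Ga`, `Cm` (`trK_comp` twice + `comp_assoc_tame`). -/
theorem trK_HRp (hGaSymm : ∀ x z κ m, Ga x z κ m = Ga z x m κ) (hCmSymm : ∀ y y' m l, Cm y y' m l = Cm y' y l m)
    (hGa : Spr Ga) (hCm : Spr Cm) : trK (HRp n Ga Cm) = HRbp n Ga Cm := by
  rw [HRp, trK_comp, trK_comp, trK_Gp hGaSymm, trK_Cp n hCmSymm, HRbp]
  have : trK (trK (Qp n)) = Qp n := rfl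
  rw [this]
  exact (comp_assoc_tame (spr_Cp n hCm).tame (spr_Qp n).tame (spr_Gp hGa).tame).symm

/-- [folklore] **`(ℋ♭_R)ᵀ = ℋ_R`**. -/
theorem trK_HRbp (hGaSymm : ∀ x z κ m, Ga x z κ m = Ga z x m κ) (hCmSymm : ∀ y y' m l, Cm y y' m l = Cm y' y l m)
    (hGa : Spr Ga) (hCm : Spr Cm) : trK (HRbp n Ga Cm) = HRp n Ga Cm := by
  have h := congrArg trK (trK_HRp n hGaSymm hCmSymm hGa hCm)
  have e : trK (trK (HRp n Ga Cm)) = HRp n Ga Cm := rfl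
  rw [e] at h
  exact h.symm

/-- [folklore] **THE SANDWICH IS SYMMETRIC**: `(Ga𝒬ᵀCm𝒬Ga)ᵀ = Ga𝒬ᵀCm𝒬Ga`. -/
theorem trK_sandP (hGaSymm : ∀ x z κ m, Ga x z κ m = Ga z x m κ) (hCmSymm : ∀ y y' m l, Cm y y' m l = Cm y' y l m)
    (hGa : Spr Ga) (hCm : Spr Cm) : trK (sandP n Ga Cm) = sandP n Ga Cm := by
  have hG := (spr_Gp hGa).tame
  have hQ := (spr_Qp n).tame
  have hC := (spr_Cp n hCm).tame
  have hQt : Tame (trK (Qp n)) := (spr_Qp n).trK.tame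
  have e : trK (trK (Qp n)) = Qp n := rfl
  have hX : Tame (comp (Qp n) (Gp Ga)) := (spr_comp (spr_Qp n) (spr_Gp hGa)).tame
  have hCX : Tame (comp (Cp n Cm) (comp (Qp n) (Gp Ga))) := (spr_comp (spr_Cp n hCm) (spr_comp (spr_Qp n) (spr_Gp hGa))).tame
  have hQC : Tame (comp (trK (Qp n)) (Cp n Cm)) := (spr_comp (spr_Qp n).trK (spr_Cp n hCm)).tame
  -- `sandP = Gp ∘ Qpᵀ ∘ Cp ∘ Qp ∘ Gp`, a palindrome of symmetric factors
  rw [sandP, trK_comp, trK_comp, trK_Gp hGaSymm, trK_HRp n hGaSymm hCmSymm hGa hCm, HRbp, HRp,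
    ← comp_assoc_tame hG hQt hCX, ← comp_assoc_tame hG hQC hX, ← comp_assoc_tame hQt hC hX]

/-- [folklore] **THE PACKED N-LEG IS SYMMETRIC**: `trK (NlegK n Ga Cm a′) = NlegK n Ga Cm a′` for symmetric spread `Ga`, `Cm`. -/
theorem trK_NlegK (hGaSymm : ∀ x z κ m, Ga x z κ m = Ga z x m κ) (hCmSymm : ∀ y y' m l, Cm y y' m l = Cm y' y l m)
    (hGa : Spr Ga) (hCm : Spr Cm) (a' : ℝ) : trK (NlegK n Ga Cm a') = NlegK n Ga Cm a' := by
  have hC' : trK (Cp n (a' • HessKerSchurResolvent.idK - Cm)) = Cp n (a' • HessKerSchurResolvent.idK - Cm) := by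
    refine trK_Cp n fun y y' m l => ?_
    simp only [Pi.sub_apply, Pi.smul_apply, smul_eq_mul, HessKerSchurResolvent.idK_apply, hCmSymm y y' m l]
    by_cases h : y = y' ∧ m = l
    · obtain ⟨rfl, rfl⟩ := h; rfl
    · rw [if_neg h, if_neg (fun h' => h ⟨h'.1.symm, h'.2.symm⟩)]
  funext x y a b
  simp only [NlegK, trK_apply, Pi.add_apply, Pi.sub_apply, Pi.smul_apply, smul_eq_mul]
  have e1 := congrFun (congrFun (congrFun (congrFun (trK_Gp hGaSymm) x) y) a) b
  have e2 := congrFun (congrFun (congrFun (congrFun (trK_sandP n hGaSymm hCmSymm hGa hCm) x) y) a) b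
  have e3 := congrFun (congrFun (congrFun (congrFun (trK_HRp n hGaSymm hCmSymm hGa hCm) x) y) a) b
  have e4 := congrFun (congrFun (congrFun (congrFun (trK_HRbp n hGaSymm hCmSymm hGa hCm) x) y) a) b
  have e5 := congrFun (congrFun (congrFun (congrFun hC' x) y) a) b
  simp only [trK_apply] at e1 e2 e3 e4 e5
  rw [e1, e2, e3, e4, e5]
  ring

/-- [folklore] **THE SHIFTED MULTIPLIER IS SYMMETRIC**: `multM n a′ c y y′ m l = multM n a′ c y′ y l m` (`KernelSpecInstance.wΦ_reciprocity`). -/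
theorem multM_symm (a' c : ℝ) (y y' : Fin 4 → ℤ) (m l : Fin 4) : multM n a' c y y' m l = multM n a' c y' y l m := by
  rw [multM_apply, multM_apply, wΦ_reciprocity (N := n) m l y y']
  congr 3
  by_cases h : y = y' ∧ m = l
  · obtain ⟨rfl, rfl⟩ := h; rfl
  · rw [if_neg h, if_neg (fun h' => h ⟨h'.1.symm, h'.2.symm⟩)]

/-- [folklore] **THE ROAD'S N-LEG IS SYMMETRIC**, modulo `Spr (Ga (m+1) a)` (`GluonLeg.Ga_symm`, `multM_symm`). -/
theorem trK_NlegRoad (m : ℕ) {a : ℝ} (ha : 0 < a) (hGa : Spr (GluonLeg.Ga (m + 1) a)) : trK (NlegRoad m a) = NlegRoad m a :=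
  trK_NlegK (m + 1) (fun x z κ m' => Ga_symm (m + 1) a (Nat.le_add_left 1 m) ha x z κ m') (multM_symm (m + 1) _ _) hGa
    (spr_multM (m + 1) _ _) _

end Symmetry

end Summit.QuantumFields.BalabanUV.Beta.D1BFx.RWeightedLegPack

end
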